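import Summits.ResolutionOfSingularities.ResolutionOfSingularities.Theorems.PurityTransfer.Negative.ResidueDefs

/-!
# `PurityTransfer` (crux stmt-ResolutionOfSingularities-17142) — negative side, file 2/5:
# calculus of the twisted derivations and of the halving operator (generic Hahn series)

Properties of the definitions of `ResidueDefs`: the twist and `D e θ` are derivations (`twist_mul`,
`D_mul`), they commute when each character kills the other's shift (`D_comm`), the logarithmic
derivative is a homomorphism (`dlog_mul`) and mixed logarithmic second derivatives agree
(`D_dlog_comm`, "curl-freeness", which is what makes `b · dlog b ∧ dlog c` exact); squares of Hahn
series in characteristic two are supported on doubled exponents (`coeff_mul_self_add_self`,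
`coeff_mul_self_eq_zero`, by the swap involution on the antidiagonal); the halving operator is
additive, inverts doubling of monomials, and is SEMILINEAR over `𝔽₂`:
`halve (a² f) = a · halve f` (`halve_mul_self_mul`). Nothing here refutes the crux. [folklore]
-/

noncomputable section

-- single-problem summit: the doubled namespace component `ResolutionOfSingularities` is forced
set_option linter.dupNamespace false

open Finset

namespace Summit.ResolutionOfSingularities.ResolutionOfSingularities.Theorems.PurityTransfer.Negative

/-! ## Twisted derivations -/

section Generic

variable {Γ : Type*} [AddCommGroup Γ] [LinearOrder Γ]
variable {R : Type*} [CommRing R]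

/-- coefficients of the twist. -/
@[simp] theorem coeff_twist (θ : Γ →+ R) (x : HahnSeries Γ R) (g : Γ) :
    (twist θ x).coeff g = θ g * x.coeff g := rfl

/-- twisting does not enlarge the support. -/
theorem support_twist_subset (θ : Γ →+ R) (x : HahnSeries Γ R) :
    (twist θ x).support ⊆ x.support := by
  intro g hg
  simp only [HahnSeries.mem_support, coeff_twist, ne_eq] at hg ⊢
  intro h
  exact hg (by rw [h, mul_zero])

/-- the twist is additive. -/
theorem twist_add (θ : Γ →+ R) (x y : HahnSeries Γ R) :
    twist θ (x + y) = twist θ x + twist θ y := by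
  ext g
  simp [mul_add]

/-- the twist of `0`. -/
theorem twist_zero (θ : Γ →+ R) : twist θ (0 : HahnSeries Γ R) = 0 := by
  ext g; simp

/-- the twist commutes with negation. -/
theorem twist_neg (θ : Γ →+ R) (x : HahnSeries Γ R) : twist θ (-x) = -twist θ x := by
  ext g; simp

/-- the twist commutes with subtraction. -/
theorem twist_sub (θ : Γ →+ R) (x y : HahnSeries Γ R) :
    twist θ (x - y) = twist θ x - twist θ y := by
  ext g; simp [mul_sub]

/-- the twist of a monomial. -/
theorem twist_single (θ : Γ →+ R) (g : Γ) (r : R) :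
    twist θ (HahnSeries.single g r) = HahnSeries.single g (θ g * r) := by
  ext a
  by_cases h : a = g
  · subst h; simp
  · simp [HahnSeries.coeff_single_of_ne h]

variable [IsOrderedAddMonoid Γ]

/-- Leibniz rule for the twist: it is a derivation. -/
theorem twist_mul (θ : Γ →+ R) (x y : HahnSeries Γ R) :
    twist θ (x * y) = twist θ x * y + x * twist θ y := by
  ext g
  rw [HahnSeries.coeff_add, coeff_twist, HahnSeries.coeff_mul,
    HahnSeries.coeff_mul_left' x.isPWO_support (support_twist_subset θ x),
    HahnSeries.coeff_mul_right' y.isPWO_support (support_twist_subset θ y),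
    Finset.mul_sum, ← Finset.sum_add_distrib]
  refine Finset.sum_congr rfl ?_
  intro ij hij
  obtain ⟨-, -, hsum⟩ := Finset.mem_antidiagonal.mp hij
  simp only [coeff_twist]
  rw [← hsum, map_add]
  ring

/-- the twist kills constants. -/
theorem twist_C (θ : Γ →+ R) (r : R) : twist θ (HahnSeries.C r) = 0 := by
  rw [HahnSeries.C_apply, twist_single, map_zero, zero_mul, HahnSeries.single_eq_zero]

/-- the twist kills `1`. -/
theorem twist_one (θ : Γ →+ R) : twist θ (1 : HahnSeries Γ R) = 0 := by
  rw [← HahnSeries.C_one]; exact twist_C θ 1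

/-- coefficients of the twisted coordinate derivation: `(D x)_g = θ(g - e) · x_{g - e}`. -/
theorem coeff_D (e : Γ) (θ : Γ →+ R) (x : HahnSeries Γ R) (g : Γ) :
    (D e θ x).coeff g = θ (g - e) * x.coeff (g - e) := by
  unfold D
  rw [HahnSeries.coeff_single_mul, one_mul, coeff_twist]

/-- `D` is additive. -/
theorem D_add (e : Γ) (θ : Γ →+ R) (x y : HahnSeries Γ R) :
    D e θ (x + y) = D e θ x + D e θ y := by
  unfold D; rw [twist_add, mul_add]

/-- `D` commutes with subtraction. -/
theorem D_sub (e : Γ) (θ : Γ →+ R) (x y : HahnSeries Γ R) :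
    D e θ (x - y) = D e θ x - D e θ y := by
  unfold D; rw [twist_sub, mul_sub]

/-- `D` commutes with negation. -/
theorem D_neg (e : Γ) (θ : Γ →+ R) (x : HahnSeries Γ R) : D e θ (-x) = -D e θ x := by
  unfold D; rw [twist_neg, mul_neg]

/-- `D 0 = 0`. -/
theorem D_zero (e : Γ) (θ : Γ →+ R) : D e θ (0 : HahnSeries Γ R) = 0 := by
  unfold D; rw [twist_zero, mul_zero]

/-- **Leibniz rule**: `D` is a derivation. -/
theorem D_mul (e : Γ) (θ : Γ →+ R) (x y : HahnSeries Γ R) :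
    D e θ (x * y) = D e θ x * y + x * D e θ y := by
  unfold D; rw [twist_mul]; ring

/-- `D` kills constants. -/
theorem D_C (e : Γ) (θ : Γ →+ R) (r : R) : D e θ (HahnSeries.C r) = 0 := by
  unfold D; rw [twist_C, mul_zero]

/-- `D 1 = 0`. -/
theorem D_one (e : Γ) (θ : Γ →+ R) : D e θ (1 : HahnSeries Γ R) = 0 := by
  unfold D; rw [twist_one, mul_zero]

/-- `D` of a monomial: `D (single g r) = single (e + g) (θ g · r)`. -/
theorem D_single (e : Γ) (θ : Γ →+ R) (g : Γ) (r : R) :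
    D e θ (HahnSeries.single g r) = HahnSeries.single (e + g) (θ g * r) := by
  unfold D; rw [twist_single, HahnSeries.single_mul_single, one_mul]

/-- Two twisted coordinate derivations commute when each character kills the other's shift. -/
theorem D_comm (e₁ e₂ : Γ) (θ₁ θ₂ : Γ →+ R) (h₁ : θ₁ e₂ = 0) (h₂ : θ₂ e₁ = 0)
    (x : HahnSeries Γ R) : D e₁ θ₁ (D e₂ θ₂ x) = D e₂ θ₂ (D e₁ θ₁ x) := by
  ext g
  simp only [coeff_D, map_sub, h₁, h₂, sub_zero]
  rw [show g - e₁ - e₂ = g - e₂ - e₁ from by abel]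
  ring

section Field

variable {F : Type*} [Field F]

/-- the logarithmic derivative is a homomorphism: `dlog (xy) = dlog x + dlog y`. -/
theorem dlog_mul (e : Γ) (θ : Γ →+ F) {x y : HahnSeries Γ F} (hx : x ≠ 0) (hy : y ≠ 0) :
    dlog e θ (x * y) = dlog e θ x + dlog e θ y := by
  unfold dlog
  rw [D_mul, mul_inv]
  field_simp

/-- `dlog 1 = 0`. -/
theorem dlog_one (e : Γ) (θ : Γ →+ F) : dlog e θ (1 : HahnSeries Γ F) = 0 := by
  unfold dlog; rw [D_one, zero_mul]

/-- `dlog x⁻¹ = - dlog x`. -/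
theorem dlog_inv (e : Γ) (θ : Γ →+ F) {x : HahnSeries Γ F} (hx : x ≠ 0) :
    dlog e θ x⁻¹ = -dlog e θ x := by
  have h := dlog_mul e θ hx (inv_ne_zero hx)
  rw [mul_inv_cancel₀ hx, dlog_one] at h
  -- 0 = dlog x + dlog x⁻¹
  have := eq_neg_of_add_eq_zero_right h.symm
  exact this

/-- `dlog (x / y) = dlog x - dlog y`. -/
theorem dlog_div (e : Γ) (θ : Γ →+ F) {x y : HahnSeries Γ F} (hx : x ≠ 0) (hy : y ≠ 0) :
    dlog e θ (x / y) = dlog e θ x - dlog e θ y := by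
  rw [div_eq_mul_inv, dlog_mul e θ hx (inv_ne_zero hy), dlog_inv e θ hy, sub_eq_add_neg]

/-- "curl-free": mixed second logarithmic derivatives agree when the derivations commute. -/
theorem D_dlog_comm (e₁ e₂ : Γ) (θ₁ θ₂ : Γ →+ F) (h₁ : θ₁ e₂ = 0) (h₂ : θ₂ e₁ = 0)
    {x : HahnSeries Γ F} (hx : x ≠ 0) :
    D e₁ θ₁ (dlog e₂ θ₂ x) = D e₂ θ₂ (dlog e₁ θ₁ x) := by
  unfold dlog
  have hinv : ∀ (e : Γ) (θ : Γ →+ F), D e θ x⁻¹ = -(D e θ x) * x⁻¹ * x⁻¹ := by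
    intro e θ
    have h := D_mul e θ x x⁻¹
    rw [mul_inv_cancel₀ hx, D_one] at h
    -- 0 = D x * x⁻¹ + x * D x⁻¹
    have h' : x * D e θ x⁻¹ = -(D e θ x * x⁻¹) := by
      have := h.symm
      rw [add_comm] at this
      exact eq_neg_of_add_eq_zero_left this
    calc D e θ x⁻¹ = x⁻¹ * (x * D e θ x⁻¹) := by rw [← mul_assoc, inv_mul_cancel₀ hx, one_mul]
      _ = -(D e θ x) * x⁻¹ * x⁻¹ := by rw [h']; ring
  rw [D_mul, D_mul, hinv e₁ θ₁, hinv e₂ θ₂, D_comm e₁ e₂ θ₁ θ₂ h₁ h₂ x]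
  ring

end Field

end Generic

/-! ## Squares in characteristic two and the halving operator -/

section Halving

variable {Γ : Type*} [AddCommGroup Γ] [LinearOrder Γ] [IsOrderedAddMonoid Γ]

/-- doubling is strictly monotone in a linearly ordered group. -/
theorem two_nsmul_strictMono : StrictMono (fun γ : Γ => γ + γ) := fun _ _ h => add_lt_add h h

/-- doubling is injective in a linearly ordered group. -/
theorem two_nsmul_injective : Function.Injective (fun γ : Γ => γ + γ) :=
  two_nsmul_strictMono.injective

/-- `γ ↦ 2γ - ℓ₀` is injective. -/
theorem dbl_injective (ℓ₀ : Γ) : Function.Injective (dbl ℓ₀) := (dbl_strictMono ℓ₀).injective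

section CharTwo

variable {R : Type*} [CommRing R]

/-- In characteristic `2`, the off-diagonal terms of a square cancel: if `δ` is not of the form
`α + α` with `α` in the support, the `δ`-coefficient of `a * a` vanishes. -/
theorem coeff_mul_self_eq_zero [CharP R 2] (a : HahnSeries Γ R) {δ : Γ}
    (h : ∀ α ∈ a.support, α + α ≠ δ) : (a * a).coeff δ = 0 := by
  rw [HahnSeries.coeff_mul]
  refine Finset.sum_involution (fun ij _ => ij.swap) ?_ ?_ ?_ ?_
  · intro ij hij
    have h2 : (2 : R) = 0 := by
      have := CharP.cast_eq_zero R 2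
      simpa using this
    calc a.coeff ij.1 * a.coeff ij.2 + a.coeff ij.swap.1 * a.coeff ij.swap.2
        = 2 * (a.coeff ij.1 * a.coeff ij.2) := by simp only [Prod.fst_swap, Prod.snd_swap]; ring
      _ = 0 := by rw [h2, zero_mul]
  · intro ij hij _ heq
    obtain ⟨hi, -, hsum⟩ := Finset.mem_antidiagonal.mp hij
    have h1 : ij.1 = ij.2 := by
      have := congrArg Prod.snd heq
      simpa using this
    apply h ij.1 hi
    rw [← hsum, ← h1]
  · intro ij hij
    exact Finset.swap_mem_antidiagonal.mpr hij
  · intro ij hij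
    simp

/-- In characteristic `2`, the `(α + α)`-coefficient of `a * a` is the square of the
`α`-coefficient. -/
theorem coeff_mul_self_add_self [CharP R 2] (a : HahnSeries Γ R) (α : Γ) :
    (a * a).coeff (α + α) = a.coeff α * a.coeff α := by
  classical
  by_cases hα : a.coeff α = 0
  · rw [hα, mul_zero]
    apply coeff_mul_self_eq_zero
    intro β hβ hβα
    have : β = α := two_nsmul_injective hβα
    subst this
    exact (HahnSeries.mem_support _ _).mp hβ hα
  · rw [HahnSeries.coeff_mul]
    have hmem : (α, α) ∈ Finset.antidiagonal a.isPWO_support a.isPWO_support (α + α) :=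
      Finset.mem_antidiagonal.mpr ⟨(HahnSeries.mem_support _ _).mpr hα,
        (HahnSeries.mem_support _ _).mpr hα, rfl⟩
    rw [← Finset.add_sum_erase _ _ hmem]
    simp only
    rw [add_eq_left]
    refine Finset.sum_involution (fun ij _ => ij.swap) ?_ ?_ ?_ ?_
    · intro ij hij
      have h2 : (2 : R) = 0 := by
        have := CharP.cast_eq_zero R 2
        simpa using this
      calc a.coeff ij.1 * a.coeff ij.2 + a.coeff ij.swap.1 * a.coeff ij.swap.2
          = 2 * (a.coeff ij.1 * a.coeff ij.2) := by simp only [Prod.fst_swap, Prod.snd_swap]; ring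
        _ = 0 := by rw [h2, zero_mul]
    · intro ij hij _ heq
      obtain ⟨hne, hij'⟩ := Finset.mem_erase.mp hij
      obtain ⟨hi, -, hsum⟩ := Finset.mem_antidiagonal.mp hij'
      have h1 : ij.1 = ij.2 := by
        have := congrArg Prod.snd heq
        simpa using this
      apply hne
      have : ij.1 = α := by
        apply two_nsmul_injective
        show ij.1 + ij.1 = α + α
        rw [← hsum, ← h1]
      ext <;> simp [← h1, this]
    · intro ij hij
      obtain ⟨hne, hij'⟩ := Finset.mem_erase.mp hij
      refine Finset.mem_erase.mpr ⟨?_, Finset.swap_mem_antidiagonal.mpr hij'⟩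
      intro h
      apply hne
      have := congrArg Prod.swap h
      simpa using this
    · intro ij hij
      simp

end CharTwo

section Halve

variable {R : Type*} [CommRing R]

/-- coefficients of the halving operator. -/
@[simp] theorem coeff_halve (ℓ₀ : Γ) (f : HahnSeries Γ R) (γ : Γ) :
    (halve ℓ₀ f).coeff γ = f.coeff (γ + γ - ℓ₀) := rfl

/-- halving is additive. -/
theorem halve_add (ℓ₀ : Γ) (f g : HahnSeries Γ R) : halve ℓ₀ (f + g) = halve ℓ₀ f + halve ℓ₀ g := by
  ext γ; simp

/-- halving commutes with subtraction. -/
theorem halve_sub (ℓ₀ : Γ) (f g : HahnSeries Γ R) : halve ℓ₀ (f - g) = halve ℓ₀ f - halve ℓ₀ g := by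
  ext γ; simp

/-- halving commutes with negation. -/
theorem halve_neg (ℓ₀ : Γ) (f : HahnSeries Γ R) : halve ℓ₀ (-f) = -halve ℓ₀ f := by
  ext γ; simp

/-- halving of `0`. -/
theorem halve_zero (ℓ₀ : Γ) : halve ℓ₀ (0 : HahnSeries Γ R) = 0 := by
  ext γ; simp

/-- `ℓ ∘ halve = ℓ` for the coefficient functional at `ℓ₀`. -/
theorem coeff_halve_self (ℓ₀ : Γ) (f : HahnSeries Γ R) : (halve ℓ₀ f).coeff ℓ₀ = f.coeff ℓ₀ := by
  simp

/-- halving a monomial whose exponent lies in the coset `2Γ - ℓ₀`. -/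
theorem halve_single_dbl (ℓ₀ γ : Γ) (r : R) :
    halve ℓ₀ (HahnSeries.single (dbl ℓ₀ γ) r) = HahnSeries.single γ r := by
  ext δ
  by_cases h : δ = γ
  · subst h; simp [dbl]
  · rw [HahnSeries.coeff_single_of_ne h, coeff_halve,
      HahnSeries.coeff_single_of_ne (fun h' => h (dbl_injective ℓ₀ (by simpa [dbl] using h')))]

/-- halving kills a monomial whose exponent lies outside the coset `2Γ - ℓ₀`. -/
theorem halve_single_of_not_mem_range (ℓ₀ δ : Γ) (r : R) (h : ∀ γ, dbl ℓ₀ γ ≠ δ) :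
    halve ℓ₀ (HahnSeries.single δ r) = 0 := by
  ext γ
  rw [coeff_halve, HahnSeries.coeff_zero, HahnSeries.coeff_single_of_ne]
  exact fun h' => h γ (by simpa [dbl] using h')

end Halve

/-- **Semilinearity of halving over `𝔽₂`**: `halve (a² f) = a · halve f`. -/
theorem halve_mul_self_mul (ℓ₀ : Γ) (a f : HahnSeries Γ (ZMod 2)) :
    halve ℓ₀ (a * a * f) = a * halve ℓ₀ f := by
  classical
  have hsq : ∀ r : ZMod 2, r * r = r := by decide
  ext γ
  rw [coeff_halve, HahnSeries.coeff_mul (x := a)]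
  -- LHS: use the superset `s` of the support of `a * a`
  set s : Set Γ := (fun α => α + α) '' a.support with hs_def
  have hs : s.IsPWO := a.isPWO_support.image_of_monotone (fun x y h => add_le_add h h)
  have hsub : (a * a).support ⊆ s := by
    intro δ hδ
    by_contra hns
    apply (HahnSeries.mem_support _ _).mp hδ
    apply coeff_mul_self_eq_zero
    intro α hα hαδ
    exact hns ⟨α, hα, hαδ⟩
  rw [HahnSeries.coeff_mul_left' hs hsub]
  symm
  refine Finset.sum_bij_ne_zero (fun ij _ _ => (ij.1 + ij.1, dbl ℓ₀ ij.2)) ?_ ?_ ?_ ?_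
  · intro ij hij hne
    obtain ⟨hi, hj, hsum⟩ := Finset.mem_antidiagonal.mp hij
    refine Finset.mem_antidiagonal.mpr ⟨⟨ij.1, hi, rfl⟩, ?_, ?_⟩
    · -- dbl ij.2 ∈ f.support
      exact hj
    · simp only [dbl, ← hsum]; abel
  · intro i₁ h₁₁ h₁₂ i₂ h₂₁ h₂₂ heq
    simp only [Prod.mk.injEq] at heq
    exact Prod.ext (two_nsmul_injective heq.1) (dbl_injective ℓ₀ heq.2)
  · intro δβ hδβ hne
    obtain ⟨hδ, hβ, hsum⟩ := Finset.mem_antidiagonal.mp hδβ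
    obtain ⟨α, hα, hαδ⟩ := hδ
    have hβ' : δβ.2 = dbl ℓ₀ (γ - α) := by
      have : δβ.2 = γ + γ - ℓ₀ - δβ.1 := by rw [← hsum]; abel
      rw [this, ← hαδ]; simp only [dbl]; abel
    have hfβ : f.coeff δβ.2 ≠ 0 := by
      intro h0; apply hne; rw [h0, mul_zero]
    refine ⟨(α, γ - α), Finset.mem_antidiagonal.mpr ⟨hα, ?_, add_sub_cancel α γ⟩, ?_, ?_⟩
    · show (halve ℓ₀ f).coeff (γ - α) ≠ 0
      rw [coeff_halve]; rw [hβ'] at hfβ; exact hfβ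
    · rw [coeff_halve, ← dbl, ← hβ']
      exact mul_ne_zero ((HahnSeries.mem_support _ _).mp hα) hfβ
    · ext <;> simp [hαδ, hβ']
  · intro ij hij hne
    simp only [coeff_halve]
    rw [coeff_mul_self_add_self, hsq]
    rfl

end Halving

end Summit.ResolutionOfSingularities.ResolutionOfSingularities.Theorems.PurityTransfer.Negative
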